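import Literature.Computability.Complexity.IrreducibilityLLLGcdFP
import Literature.Computability.Complexity.IrreducibilityLLLHensel
import HarnessLib

/-!
# Hensel lifting on coefficient lists runs in polynomial time (`CodeFP`)

Support file for the discharge of the named fact
`Literature.Computability.Complexity.lll_monicIrreducible_mem_P` (irreducibility of monic integer
polynomials is decidable in `P`; Lenstra–Lenstra–Lovász 1982, §3). Machine side of
`IrreducibilityLLLHensel.lean` (LLL82 (3.2), Knuth §4.6.2 ex. 22): the prime `p` and the exponent `k`
are unary, the modulus `m = p^j` binary; every reduction is modulo `p⁺ = max p 2` or `m ≥ p⁺`: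

* `pdivConstC`, `henselCofactorC`, `henselStepC`;
* unconditional size invariants of the lifting loop (`HSize`: `m = (p⁺)^{j+1}`, `U` the input factor or
  reduced modulo `m` and not longer than it, `W` reduced modulo `m` of length `≤ |w₁| + j K`);
* **`henselLiftC`**: `(p, k, f, u₁) ↦ henselLift p⁺ k f u₁`.

## References

* S. Arora, B. Barak, *Computational Complexity: A Modern Approach*, CUP 2009, §1.3. [AroraBarak2009]
* D. E. Knuth, *The Art of Computer Programming*, Vol. 2, §4.6.2, exercise 22. [KnuthTAOCP2]
* A. K. Lenstra, H. W. Lenstra Jr., L. Lovász, Math. Ann. 261 (1982), §3 (3.2). [LenstraLenstraLovasz1982]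
-/

noncomputable section

namespace Literature.Computability.Complexity

open Polynomial SumcheckMA CodeFP Brick _root_.Computability

namespace LLLFactoring

/-- The encoder of coefficient lists. -/
local notation "L" => rawE intE

/-! ### The primitives on codes -/

/-- **`pdivConst m e`** on codes. [folklore] -/
theorem pdivConstC : CodeFP (pairE natE L) L (fun t => pdivConst t.1 t.2) :=
  ((map (σ := ℕ) (eσ := natE) (g := fun t : ℕ × ℤ => t.2 / (t.1 : ℤ)) ((intEDiv.comp ((snd _ _).pair (intOfNat.comp (fst _ _))) :))).congr
    fun _ => rfl)

/-- **`henselCofactor p⁺ f u₁`** on codes. [cite: LenstraLenstraLovasz1982, (3.2)] -/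
theorem henselCofactorC : CodeFP (pairE unE (pairE L L)) L (fun t => henselCofactor (max t.1 2) t.2.1 t.2.2) :=
  ((pnormC.comp ((maxTwoUnC.comp (fst _ _)).pair (pdivmodC.comp ((natOfUn.comp (fst _ _)).pair (snd _ _))).fst')).congr fun _ => rfl)

/-- The encoder of the lifting context `(p, f, u₁, w₁, t)` and state `(m, U, W)`. -/
local notation "HC" => pairE unE (pairE (rawE intE) (pairE (rawE intE) (pairE (rawE intE) (rawE intE))))
/-- The encoder of the lifting state `(m, U, W)`. -/
local notation "HS" => pairE natE (pairE (rawE intE) (rawE intE))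

/-- **One lifting step** on codes: `((p, f, u₁, w₁, t), (m, U, W)) ↦ henselStep p⁺ f u₁ w₁ t (m, U, W)`.
[cite: KnuthTAOCP2, §4.6.2, exercise 22] -/
theorem henselStepC : CodeFP (pairE HC HS) HS (fun t => henselStep (max t.1.1 2) t.1.2.1 t.1.2.2.1 t.1.2.2.2.1 t.1.2.2.2.2 t.2) := by
  have hp : CodeFP (pairE HC HS) unE (fun t => t.1.1) := ((fst _ _).fst' :)
  have hP : CodeFP (pairE HC HS) natE (fun t => max t.1.1 2) := (maxTwoUnC.comp hp :)
  have hf : CodeFP (pairE HC HS) L (fun t => t.1.2.1) := ((fst _ _).snd'.fst' :)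
  have hu : CodeFP (pairE HC HS) L (fun t => t.1.2.2.1) := ((fst _ _).snd'.snd'.fst' :)
  have hw : CodeFP (pairE HC HS) L (fun t => t.1.2.2.2.1) := ((fst _ _).snd'.snd'.snd'.fst' :)
  have ht : CodeFP (pairE HC HS) L (fun t => t.1.2.2.2.2) := ((fst _ _).snd'.snd'.snd'.snd' :)
  have hm : CodeFP (pairE HC HS) natE (fun t => t.2.1) := ((snd _ _).fst' :)
  have hU : CodeFP (pairE HC HS) L (fun t => t.2.2.1) := ((snd _ _).snd'.fst' :)
  have hW : CodeFP (pairE HC HS) L (fun t => t.2.2.2) := ((snd _ _).snd'.snd' :)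
  -- `eb = pnorm p⁺ ((f - U W) / m)`
  have heb : CodeFP (pairE HC HS) L (fun t => pnorm (max t.1.1 2) (pdivConst t.2.1 (psub t.1.2.1 (pmul t.2.2.1 t.2.2.2)))) :=
    (pnormC.comp (hP.pair (pdivConstC.comp (hm.pair (psubC.comp (hf.pair (pmulC.comp (hU.pair hW))))))) :)
  -- `τ = (t eb) mod u₁`, `σ = ((eb - τ w₁) / u₁)` normalised
  have hτ : CodeFP (pairE HC HS) L (fun t => pmodM (max t.1.1 2) (pmul t.1.2.2.2.2 (pnorm (max t.1.1 2) (pdivConst t.2.1 (psub t.1.2.1 (pmul t.2.2.1 t.2.2.2))))) t.1.2.2.1) :=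
    ((pmodMC.comp ((natOfUn.comp hp).pair ((pmulC.comp (ht.pair heb)).pair hu))).congr fun _ => rfl)
  have hσ : CodeFP (pairE HC HS) L (fun t => pnorm (max t.1.1 2) (pdivmod (max t.1.1 2) (psub (pnorm (max t.1.1 2) (pdivConst t.2.1 (psub t.1.2.1 (pmul t.2.2.1 t.2.2.2))))
      (pmul (pmodM (max t.1.1 2) (pmul t.1.2.2.2.2 (pnorm (max t.1.1 2) (pdivConst t.2.1 (psub t.1.2.1 (pmul t.2.2.1 t.2.2.2))))) t.1.2.2.1) t.1.2.2.2.1)) t.1.2.2.1).1) :=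
    ((pnormC.comp (hP.pair (pdivmodC.comp ((natOfUn.comp hp).pair ((psubC.comp (heb.pair (pmulC.comp (hτ.pair hw)))).pair hu))).fst')).congr fun _ => rfl)
  have hm' : CodeFP (pairE HC HS) natE (fun t => t.2.1 * max t.1.1 2) := (natMul.comp (hm.pair hP) :)
  have hU' : CodeFP (pairE HC HS) L (fun t => pnorm (t.2.1 * max t.1.1 2) (padd t.2.2.1 (pscale (t.2.1 : ℤ)
      (pmodM (max t.1.1 2) (pmul t.1.2.2.2.2 (pnorm (max t.1.1 2) (pdivConst t.2.1 (psub t.1.2.1 (pmul t.2.2.1 t.2.2.2))))) t.1.2.2.1)))) :=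
    (pnormC.comp (hm'.pair (paddC.comp (hU.pair (pscaleC.comp ((intOfNat.comp hm).pair hτ))))) :)
  have hW' : CodeFP (pairE HC HS) L (fun t => pnorm (t.2.1 * max t.1.1 2) (padd t.2.2.2 (pscale (t.2.1 : ℤ)
      (pnorm (max t.1.1 2) (pdivmod (max t.1.1 2) (psub (pnorm (max t.1.1 2) (pdivConst t.2.1 (psub t.1.2.1 (pmul t.2.2.1 t.2.2.2))))
        (pmul (pmodM (max t.1.1 2) (pmul t.1.2.2.2.2 (pnorm (max t.1.1 2) (pdivConst t.2.1 (psub t.1.2.1 (pmul t.2.2.1 t.2.2.2))))) t.1.2.2.1) t.1.2.2.2.1)) t.1.2.2.1).1)))) :=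
    (pnormC.comp (hm'.pair (paddC.comp (hW.pair (pscaleC.comp ((intOfNat.comp hm).pair hσ))))) :)
  refine ((hm'.pair (hU'.pair hW')).congr fun t => ?_)
  rfl

/-! ### Unconditional sizes along the lifting loop -/

/-- The remainder by the empty divisor is empty (all of `a` is consumed). [folklore] -/
theorem pdivmod_nil_snd (M : ℕ) (a : List ℤ) : (pdivmod M a []).2 = [] := by
  have key : ∀ j : ℕ, ((List.replicate j ()).foldl (fun st _ => divStep M [] st) ([], pmod M a)).2.length = a.length - j := by
    intro j
    induction j with
    | zero => simp
    | succ j ih =>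
      rw [List.replicate_succ', List.foldl_append, List.foldl_cons, List.foldl_nil, divStep, if_neg (by simp)]
      simp only [List.length_dropLast, length_pmod, length_psub, SumcheckMA.length_pshift_pscale, List.length_nil]
      rw [ih]; omega
  have := key (a.length + 1)
  rw [pdivmod, List.length_nil, Nat.sub_zero, ← List.length_eq_zero_iff, this]
  omega

/-- `pmodM` is never longer than its divisor (by the empty divisor it is empty). [folklore] -/
theorem length_pmodM_le_divisor (M : ℕ) (a W : List ℤ) : (pmodM M a W).length ≤ W.length := by
  by_cases hW : W = []
  · subst hW; rw [pmodM, pdivmod_nil_snd]; simp [pnorm, pmod, trim, List.rdropWhile]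
  · exact ((length_pmodM_le' M a W).2 hW).le

/-- The size invariant after `j` steps: `m = P^{j+1}`; `U` is the input factor or reduced modulo `m`,
`|U| ≤ |u₁|`; `W` is the input cofactor or reduced modulo `m`, `|W| ≤ |w₁| + j K`
(`K = 2|u₁| + |f| + |w₁| + 1`). [folklore] -/
def HSize (P : ℕ) (f u₁ w₁ : List ℤ) (j : ℕ) (st : ℕ × List ℤ × List ℤ) : Prop :=
  st.1 = P ^ (j + 1) ∧ (st.2.1 = u₁ ∨ Reduced st.1 st.2.1) ∧ st.2.1.length ≤ u₁.length ∧ (st.2.2 = w₁ ∨ Reduced st.1 st.2.2) ∧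
    st.2.2.length ≤ w₁.length + j * (2 * u₁.length + f.length + w₁.length + 1)

/-- **One lifting step keeps the size invariant** (`P ≥ 1`). [folklore] -/
theorem hsize_step {P : ℕ} (hP : 0 < P) {f u₁ w₁ t : List ℤ} {j : ℕ} {st : ℕ × List ℤ × List ℤ}
    (h : HSize P f u₁ w₁ j st) : HSize P f u₁ w₁ (j + 1) (henselStep P f u₁ w₁ t st) := by
  obtain ⟨m, U, W⟩ := st
  obtain ⟨hm, -, hUl, -, hWl⟩ := h
  dsimp only at hm hUl hWl
  subst hm
  have hm0 : 0 < P ^ (j + 1) * P := Nat.mul_pos (Nat.pow_pos hP) hP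
  set eb := pnorm P (pdivConst (P ^ (j + 1)) (psub f (pmul U W))) with heb
  set τ := pmodM P (pmul t eb) u₁ with hτ
  set σ := pnorm P (pdivmod P (psub eb (pmul τ w₁)) u₁).1 with hσ
  have hτl : τ.length ≤ u₁.length := length_pmodM_le_divisor P _ u₁
  have hebl : eb.length ≤ max f.length (U.length + W.length) :=
    (length_pnorm_le _).trans (by rw [length_pdivConst, length_psub]; exact max_le_max le_rfl (length_pmul_le U W))
  have hσl : σ.length ≤ max eb.length (τ.length + w₁.length) + 1 :=
    (length_pnorm_le _).trans ((length_pdivmod_fst_le _ _ _).trans (by rw [length_psub]; exact Nat.add_le_add_right (max_le_max le_rfl (length_pmul_le _ _)) 1))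
  show HSize P f u₁ w₁ (j + 1) (P ^ (j + 1) * P, pnorm (P ^ (j + 1) * P) (padd U (pscale ((P ^ (j + 1) : ℕ) : ℤ) τ)),
    pnorm (P ^ (j + 1) * P) (padd W (pscale ((P ^ (j + 1) : ℕ) : ℤ) σ)))
  refine ⟨(pow_succ P (j + 1)).symm, Or.inr (normal_pnorm hm0 _).1, ?_, Or.inr (normal_pnorm hm0 _).1, ?_⟩
  · refine (length_pnorm_le _).trans ?_
    rw [length_padd, pscale, List.length_map]
    exact max_le hUl hτl
  · refine (length_pnorm_le _).trans ?_
    rw [length_padd, pscale, List.length_map]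
    have hK : w₁.length + j * (2 * u₁.length + f.length + w₁.length + 1) + (2 * u₁.length + f.length + w₁.length + 1) =
        w₁.length + (j + 1) * (2 * u₁.length + f.length + w₁.length + 1) := by ring
    refine max_le (hWl.trans (by rw [← hK]; exact Nat.le_add_right _ _)) (hσl.trans ?_)
    have h1 : max eb.length (τ.length + w₁.length) + 1 ≤ W.length + (2 * u₁.length + f.length + w₁.length + 1) := by
      have := hebl; have := hτl; have := hUl; omega
    refine h1.trans ?_
    rw [← hK]; omega

/-- The initial state `(P, u₁, w₁)` has the invariant with `j = 0`. [folklore] -/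
theorem hsize_init (P : ℕ) (f u₁ w₁ : List ℤ) : HSize P f u₁ w₁ 0 (P, u₁, w₁) :=
  ⟨(pow_one P).symm, Or.inl rfl, le_rfl, Or.inl rfl, by simp⟩

/-- **The run**: the invariant after any number of steps, on every input. [folklore] -/
theorem hsize_run {P : ℕ} (hP : 0 < P) (f u₁ w₁ t : List ℤ) (u : List Unit) :
    HSize P f u₁ w₁ u.length (u.foldl (fun st _ => henselStep P f u₁ w₁ t st) (P, u₁, w₁)) := by
  induction u using List.reverseRecOn with
  | nil => exact hsize_init P f u₁ w₁
  | append_singleton u x ih =>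
    rw [List.foldl_append, List.foldl_cons, List.foldl_nil, List.length_append, List.length_singleton]
    exact hsize_step hP ih

/-- The bit length of the modulus along the run: `size (P^{j+1}) ≤ (j+1) size P + 1`. [folklore] -/
theorem size_pow_succ_le (P j : ℕ) : Nat.size (P ^ (j + 1)) ≤ (j + 1) * Nat.size P + 1 := size_pow_le P (j + 1)

/-- Arithmetic: the code of `U`. [folklore] -/
theorem arithU (Lc : ℕ) : Lc * (6 * (Lc + (Lc + 2) ^ 2) + 6) ≤ 13 * (Lc + 2) ^ 3 :=
  Nat.le.intro (k := 7 * Lc ^ 3 + 48 * Lc ^ 2 + 126 * Lc + 104) (by ring)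

/-- Arithmetic: the code of `W`. [folklore] -/
theorem arithW (Lc : ℕ) : (4 * (Lc + 1) ^ 2) * (6 * (4 * (Lc + 1) ^ 2 + (Lc + 2) ^ 2) + 6) ≤ 150 * (Lc + 2) ^ 4 :=
  Nat.le.intro (k := 30 * (Lc + 1) ^ 4 + 552 * (Lc + 1) ^ 3 + 852 * (Lc + 1) ^ 2 + 600 * (Lc + 1) + 150) (by ring)

/-- Arithmetic: the length of `W`. [folklore] -/
theorem arithWlen {Lc w l u f : ℕ} (hw : w ≤ Lc) (hl : l ≤ Lc) (hu : u ≤ Lc) (hf : f ≤ Lc) :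
    w + l * (2 * u + f + w + 1) ≤ 4 * (Lc + 1) ^ 2 := by
  calc w + l * (2 * u + f + w + 1) ≤ Lc + Lc * (4 * Lc + 1) := Nat.add_le_add hw (Nat.mul_le_mul hl (by omega))
    _ ≤ 4 * (Lc + 1) ^ 2 := Nat.le.intro (k := 6 * Lc + 4) (by ring)

/-- Arithmetic: the bit length of the modulus. [folklore] -/
theorem arithM {Lc l s : ℕ} (hl : l ≤ Lc) (hs : s ≤ Lc + 2) : (l + 1) * s + 1 ≤ (Lc + 2) ^ 2 := by
  calc (l + 1) * s + 1 ≤ (Lc + 1) * (Lc + 2) + 1 := Nat.add_le_add_right (Nat.mul_le_mul (by omega) hs) 1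
    _ ≤ (Lc + 2) ^ 2 := Nat.le.intro (k := Lc + 1) (by ring)

/-- Arithmetic: small things are below powers. [folklore] -/
theorem le_pow_add_two (Lc : ℕ) {c k : ℕ} (hc : 1 ≤ c) (hk : 1 ≤ k) : Lc ≤ c * (Lc + 2) ^ k :=
  calc Lc ≤ Lc + 2 := by omega
    _ ≤ (Lc + 2) ^ k := Nat.le_self_pow (by omega) _
    _ ≤ c * (Lc + 2) ^ k := Nat.le_mul_of_pos_left _ hc

/-- **Hensel lifting `henselLift p⁺ k f u₁`** on codes (`p`, `k` unary): the cofactor and the Bezout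
coefficient are computed once, then `k - 1` steps of `henselStepC` are folded (state of `hsize_run`).
[cite: LenstraLenstraLovasz1982, (3.2)] [cite: AroraBarak2009, §1.3] -/
theorem henselLiftC : CodeFP (pairE unE (pairE unE (pairE L L))) L (fun t => henselLift (max t.1 2) t.2.1 t.2.2.1 t.2.2.2) := by
  -- the context `(p, f, u₁, w₁, t)` from the input `(p, k, f, u₁)`
  have hp : CodeFP (pairE unE (pairE unE (pairE L L))) unE (fun t => t.1) := (fst _ _ :)
  have hf : CodeFP (pairE unE (pairE unE (pairE L L))) L (fun t => t.2.2.1) := ((snd _ _).snd'.fst' :)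
  have hu : CodeFP (pairE unE (pairE unE (pairE L L))) L (fun t => t.2.2.2) := ((snd _ _).snd'.snd' :)
  have hw : CodeFP (pairE unE (pairE unE (pairE L L))) L (fun t => henselCofactor (max t.1 2) t.2.2.1 t.2.2.2) :=
    (henselCofactorC.comp (hp.pair (hf.pair hu)) :)
  have htt : CodeFP (pairE unE (pairE unE (pairE L L))) L (fun t => (pxgcd (max t.1 2) t.2.2.2 (henselCofactor (max t.1 2) t.2.2.1 t.2.2.2)).2.2) :=
    ((pxgcdC.comp (hp.pair (hu.pair hw))).snd'.snd' :)
  have hctx : CodeFP (pairE unE (pairE unE (pairE L L))) HC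
      (fun t => (t.1, t.2.2.1, t.2.2.2, henselCofactor (max t.1 2) t.2.2.1 t.2.2.2,
        (pxgcd (max t.1 2) t.2.2.2 (henselCofactor (max t.1 2) t.2.2.1 t.2.2.2)).2.2)) :=
    (hp.pair (hf.pair (hu.pair (hw.pair htt))) :)
  have hstep : CodeFP (pairE HC (pairE unitE HS)) HS (fun t => henselStep (max t.1.1 2) t.1.2.1 t.1.2.2.1 t.1.2.2.2.1 t.1.2.2.2.2 t.2.2) :=
    (henselStepC.comp ((fst _ _).pair (snd _ _).snd') :)
  have hinit : CodeFP HC HS (fun s => (max s.1 2, s.2.2.1, s.2.2.2.1)) :=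
    ((maxTwoUnC.comp (fst _ _)).pair ((snd _ _).snd'.fst'.pair (snd _ _).snd'.snd'.fst') :)
  have hfold := foldl (σ := ℕ × List ℤ × List ℤ × List ℤ × List ℤ) (α := Unit) (β := ℕ × List ℤ × List ℤ) (eσ := HC) (eα := unitE) (eβ := HS)
    (step := fun s _ st => henselStep (max s.1 2) s.2.1 s.2.2.1 s.2.2.2.1 s.2.2.2.2 st) (init := fun s => (max s.1 2, s.2.2.1, s.2.2.2.1)) hstep hinit
    (200 * (X + 2) ^ 4) (fun s l₁ l₂ => by
      obtain ⟨p, f, u₁, w₁, t⟩ := s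
      change (pairE natE (pairE L L) (l₁.foldl (fun st (_ : Unit) => henselStep (max p 2) f u₁ w₁ t st) (max p 2, u₁, w₁))).length ≤ _
      set Lc := (pairE HC (rawE unitE) ((p, f, u₁, w₁, t), l₁ ++ l₂)).length with hLc
      have hP : 0 < max p 2 := lt_of_lt_of_le (by norm_num) (le_max_right _ _)
      obtain ⟨hm, hUc, hUl, hWc, hWl⟩ := hsize_run hP f u₁ w₁ t l₁
      set st := l₁.foldl (fun st (_ : Unit) => henselStep (max p 2) f u₁ w₁ t st) (max p 2, u₁, w₁)
      -- the pieces of the input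
      have hLf : (rawE intE f).length ≤ Lc := by rw [hLc]; simp only [pairE_apply, length_boolPair]; omega
      have hLu : (rawE intE u₁).length ≤ Lc := by rw [hLc]; simp only [pairE_apply, length_boolPair]; omega
      have hLw : (rawE intE w₁).length ≤ Lc := by rw [hLc]; simp only [pairE_apply, length_boolPair]; omega
      have hLp : p ≤ Lc := by rw [hLc]; simp only [pairE_apply, length_boolPair, length_unE]; omega
      have hLl : l₁.length ≤ Lc := by
        rw [hLc]; simp only [pairE_apply, length_boolPair]
        have := length_le_length_rawE unitE (l₁ ++ l₂); rw [List.length_append] at this; omega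
      have hfl := (length_le_code f).trans hLf
      have hul := (length_le_code u₁).trans hLu
      have hwl := (length_le_code w₁).trans hLw
      -- the modulus
      have hszP : Nat.size (max p 2) ≤ Lc + 2 := (size_max_two_le p).trans (by have := Nat.size_le.2 (Nat.lt_two_pow_self (n := p)); omega)
      have hszm : Nat.size st.1 ≤ (Lc + 2) ^ 2 := by
        rw [hm]
        exact (size_pow_succ_le _ _).trans (arithM hLl hszP)
      -- `U`
      have hUcode : (rawE intE st.2.1).length ≤ 13 * (Lc + 2) ^ 3 := by
        rcases hUc with h | hred
        · rw [h]; exact hLu.trans (le_pow_add_two Lc (by norm_num) (by norm_num))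
        · refine (length_rawE_intE_le_of_reduced hred).trans ?_
          have h1 : Nat.size st.2.1.length ≤ Lc := (Nat.size_le.2 (Nat.lt_two_pow_self)).trans (hUl.trans hul)
          calc st.2.1.length * (6 * (Nat.size st.2.1.length + Nat.size st.1) + 6) ≤ Lc * (6 * (Lc + (Lc + 2) ^ 2) + 6) :=
                Nat.mul_le_mul (hUl.trans hul) (by omega)
            _ ≤ 13 * (Lc + 2) ^ 3 := arithU Lc
      -- `W`
      have hWlen : st.2.2.length ≤ 4 * (Lc + 1) ^ 2 := hWl.trans (arithWlen hwl hLl hul hfl)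
      have hWcode : (rawE intE st.2.2).length ≤ 150 * (Lc + 2) ^ 4 := by
        rcases hWc with h | hred
        · rw [h]; exact hLw.trans (le_pow_add_two Lc (by norm_num) (by norm_num))
        · refine (length_rawE_intE_le_of_reduced hred).trans ?_
          have h1 : Nat.size st.2.2.length ≤ 4 * (Lc + 1) ^ 2 := (Nat.size_le.2 (Nat.lt_two_pow_self)).trans hWlen
          calc st.2.2.length * (6 * (Nat.size st.2.2.length + Nat.size st.1) + 6) ≤ (4 * (Lc + 1) ^ 2) * (6 * (4 * (Lc + 1) ^ 2 + (Lc + 2) ^ 2) + 6) :=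
                Nat.mul_le_mul hWlen (by omega)
            _ ≤ 150 * (Lc + 2) ^ 4 := arithW Lc
      have hmcode : (natE st.1).length ≤ (Lc + 2) ^ 2 := by rw [length_natE]; exact hszm
      have hpow2 : (Lc + 2) ^ 2 ≤ (Lc + 2) ^ 4 := Nat.pow_le_pow_right (by omega) (by norm_num)
      have hpow3 : (Lc + 2) ^ 3 ≤ (Lc + 2) ^ 4 := Nat.pow_le_pow_right (by omega) (by norm_num)
      have hone : 1 ≤ (Lc + 2) ^ 4 := Nat.one_le_pow _ _ (by omega)
      simp only [pairE_apply, length_boolPair, eval_mul, eval_pow, eval_add, eval_X, eval_ofNat]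
      omega)
  have hticks : CodeFP (pairE unE (pairE unE (pairE L L))) (rawE unitE) (fun t => List.replicate (t.2.1 - 1) ()) :=
    (replicateUnit.comp ((unSubLen unitE).comp ((snd _ _).fst'.pair (const _ [()]))) :)
  refine (((hfold.comp (hctx.pair hticks)).snd'.fst').congr fun t => ?_)
  unfold henselLift henselRun
  rfl

end LLLFactoring

end Literature.Computability.Complexity
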